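import Mathlib.Algebra.Group.Basic
import Mathlib.Algebra.Module.Defs
import Mathlib.Tactic.LinearCombination
import Mathlib.Tactic.Abel
import HarnessLib

set_option linter.dupNamespace false

/-!
# Weil-type family coverage — TYPE-III WINDOWS, part E (census block b04.20): the ALGEBRAIC SKELETON of THEOREM S21 (the branch-point cocycle)

research route conditional on HC_CM; not a corollary; Q11.4-sentence-2 already refuted in dim ≥ 3.

Ring 2, WEIL-TYPE FAMILY-COVERAGE CENSUS (`HOME/WEIL-FAMILY-COVERAGE.md` `## b04`, block b04.20, owner ring2-b04, gen 56; theory note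
`HOME/pub-hodge-ring2-b04/census-g56/theory/THEOREMS-S20.md`).  SETTING (informal, not formalised): for a finite group `G` and a rational
quaternionic character `χ`, the Witt class `Θ(g_1,…,g_b) ∈ W_G` of the intersection form of the `G`-cover of `ℙ¹` with branch cycle datum
`(g_1,…,g_b)` is, by the CUT THEOREM S20 (topology: `H_1 ⊇ V^⊥ ⊇ V`, `V` the vanishing cycles of a boundary wall of the Hurwitz space),
the caterpillar sum `w(g_1,g_2) + w(g_1g_2,g_3) + ⋯ + w(g_1⋯g_{b-2}, g_{b-1})` of the three-point classes `w(x,y) := Θ(x,y,(xy)⁻¹)`, and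
`w` is a 2-cocycle; for `G` perfect with `H_2(G;ℤ)` of odd order it is a coboundary `w = δu` in every coefficient group without odd torsion
(group cohomology, universal coefficients).  THIS FILE checks in the kernel the purely algebraic steps that turn `w = δu` into the census's
working statements: (1) ROTATION ⇒ ODDNESS (`u(x⁻¹) = -u(x)`: the datum `(x,y,(xy)⁻¹)` and its rotation are the same cover), hence real
classes are 2-torsion (`2•u(c) = 0`, the source of the REAL-CLASS RAMIFICATION CRITERION S21 (c)); (2) TELESCOPING ⇒ ADDITIVITY
`Θ(g_1,…,g_b) = Σ u(g_i)` for `b = 3,…,7` (the branch-point numbers of record) — LAW HW's orthogonal-sum structure; (3) the CYCLIC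
RECURRENCE of S21 (f): `(2^t - 1)•u(g) = Σ_j 2^{t-1-j}•w(g^{2^j}, g^{2^j})` for elements of order 3 and 5 (`t = 2, 4`), which reduces the
local terms of odd-order classes to cyclic (Fermat-quotient) covers.  Abstract `G` (group) and `A` (additive commutative group) throughout.

No `def`, no named fact, no `sorry`; nothing here is a statement about Hodge classes; `HC_CM` is used nowhere.
-/

namespace Summit.HodgeConjecture.HodgeConjecture.Ring2.WeilCoverage

variable {G A : Type*} [Group G] [AddCommGroup A]

/-- ROTATION ⇒ ODDNESS (THEOREM S21 (b), census b04.20): if `u : G → A` with `u 1 = 0` has a coboundary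
`w(x,y) = u x + u y - u (x*y)` invariant under the rotation `(x, y, (xy)⁻¹) ↦ (y, (xy)⁻¹, x)` of three-point data, then `u` is odd.
research route conditional on HC_CM; not a corollary; Q11.4-sentence-2 already refuted in dim ≥ 3. -/
theorem wittCocycle_odd_of_rotation (u : G → A) (h1 : u 1 = 0)
    (hrot : ∀ x y : G, u x + u y - u (x * y) = u y + u (x * y)⁻¹ - u x⁻¹) (x : G) :
    u x⁻¹ = -u x := by
  have key : ∀ a b : G, u a + u a⁻¹ = u (a * b) + u (a * b)⁻¹ := by
    intro a b
    have h' : (u a + u b - u (a * b)) - (u b + u (a * b)⁻¹ - u a⁻¹) = 0 := sub_eq_zero.mpr (hrot a b)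
    have e : (u a + u a⁻¹) - (u (a * b) + u (a * b)⁻¹)
        = (u a + u b - u (a * b)) - (u b + u (a * b)⁻¹ - u a⁻¹) := by abel
    rw [h'] at e
    exact sub_eq_zero.mp e
  have h2 := key x x⁻¹
  rw [mul_inv_cancel, inv_one, h1, add_zero] at h2
  exact eq_neg_of_add_eq_zero_right h2

/-- REAL CLASSES ARE 2-TORSION (source of the real-class ramification criterion S21 (c), census b04.20): if `u` is odd and `x` is
conjugate to its inverse, `x⁻¹ = g * x * g⁻¹`, and `u` is a class function, then `2 • u x = 0`.
research route conditional on HC_CM; not a corollary; Q11.4-sentence-2 already refuted in dim ≥ 3. -/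
theorem wittCocycle_two_smul_eq_zero_of_real (u : G → A) (hodd : ∀ x : G, u x⁻¹ = -u x)
    (hclass : ∀ g x : G, u (g * x * g⁻¹) = u x) (x g : G) (hreal : x⁻¹ = g * x * g⁻¹) :
    (2 : ℕ) • u x = 0 := by
  have h := hodd x
  rw [hreal, hclass] at h
  rw [two_nsmul]
  exact add_eq_zero_iff_eq_neg.mpr h

/-- ADDITIVITY, `b = 3` (THEOREM S21 (b), census b04.20): with `w(x,y) = u x + u y - u (x*y)` and `u` odd, the class of a three-point
datum `(x, y, z)`, `x*y*z = 1`, is `u x + u y + u z`.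
research route conditional on HC_CM; not a corollary; Q11.4-sentence-2 already refuted in dim ≥ 3. -/
theorem wittCocycle_additive_three (u : G → A) (hodd : ∀ x : G, u x⁻¹ = -u x) (x y z : G) (h : x * y * z = 1) :
    u x + u y - u (x * y) = u x + u y + u z := by
  have hz : z = (x * y)⁻¹ := eq_inv_of_mul_eq_one_right h
  rw [hz, hodd]
  abel

/-- ADDITIVITY, `b = 4` (THEOREM S21 (b), census b04.20): the caterpillar sum `w(g₁,g₂) + w(g₁g₂,g₃)` of a four-point datum with
`g₁g₂g₃g₄ = 1` equals `u g₁ + u g₂ + u g₃ + u g₄` — e.g. the sixteen `SL₂(5)`-`χ₆` families of b04.19 in t-2's class `T_ℍ(1,{5})`.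
research route conditional on HC_CM; not a corollary; Q11.4-sentence-2 already refuted in dim ≥ 3. -/
theorem wittCocycle_additive_four (u : G → A) (hodd : ∀ x : G, u x⁻¹ = -u x) (g₁ g₂ g₃ g₄ : G)
    (h : g₁ * g₂ * g₃ * g₄ = 1) :
    (u g₁ + u g₂ - u (g₁ * g₂)) + (u (g₁ * g₂) + u g₃ - u (g₁ * g₂ * g₃)) = u g₁ + u g₂ + u g₃ + u g₄ := by
  have hz : g₄ = (g₁ * g₂ * g₃)⁻¹ := eq_inv_of_mul_eq_one_right h
  rw [hz, hodd]
  abel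

/-- ADDITIVITY, `b = 5` (THEOREM S21 (b), census b04.20; the `SL₂(9)`-`η` five-point families of b04.19 (F)).
research route conditional on HC_CM; not a corollary; Q11.4-sentence-2 already refuted in dim ≥ 3. -/
theorem wittCocycle_additive_five (u : G → A) (hodd : ∀ x : G, u x⁻¹ = -u x) (g₁ g₂ g₃ g₄ g₅ : G)
    (h : g₁ * g₂ * g₃ * g₄ * g₅ = 1) :
    (u g₁ + u g₂ - u (g₁ * g₂)) + (u (g₁ * g₂) + u g₃ - u (g₁ * g₂ * g₃))
      + (u (g₁ * g₂ * g₃) + u g₄ - u (g₁ * g₂ * g₃ * g₄)) = u g₁ + u g₂ + u g₃ + u g₄ + u g₅ := by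
  have hz : g₅ = (g₁ * g₂ * g₃ * g₄)⁻¹ := eq_inv_of_mul_eq_one_right h
  rw [hz, hodd]
  abel

/-- ADDITIVITY, `b = 6` (THEOREM S21 (b), census b04.20; the `SL₂(9)`-`η` six-point families).
research route conditional on HC_CM; not a corollary; Q11.4-sentence-2 already refuted in dim ≥ 3. -/
theorem wittCocycle_additive_six (u : G → A) (hodd : ∀ x : G, u x⁻¹ = -u x) (g₁ g₂ g₃ g₄ g₅ g₆ : G)
    (h : g₁ * g₂ * g₃ * g₄ * g₅ * g₆ = 1) :
    (u g₁ + u g₂ - u (g₁ * g₂)) + (u (g₁ * g₂) + u g₃ - u (g₁ * g₂ * g₃))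
      + (u (g₁ * g₂ * g₃) + u g₄ - u (g₁ * g₂ * g₃ * g₄))
      + (u (g₁ * g₂ * g₃ * g₄) + u g₅ - u (g₁ * g₂ * g₃ * g₄ * g₅))
      = u g₁ + u g₂ + u g₃ + u g₄ + u g₅ + u g₆ := by
  have hz : g₆ = (g₁ * g₂ * g₃ * g₄ * g₅)⁻¹ := eq_inv_of_mul_eq_one_right h
  rw [hz, hodd]
  abel

/-- ADDITIVITY, `b = 7` (THEOREM S21 (b), census b04.20; the four-parameter `SL₂(9)`-`η` family `(3⁺)⁷`).
research route conditional on HC_CM; not a corollary; Q11.4-sentence-2 already refuted in dim ≥ 3. -/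
theorem wittCocycle_additive_seven (u : G → A) (hodd : ∀ x : G, u x⁻¹ = -u x) (g₁ g₂ g₃ g₄ g₅ g₆ g₇ : G)
    (h : g₁ * g₂ * g₃ * g₄ * g₅ * g₆ * g₇ = 1) :
    (u g₁ + u g₂ - u (g₁ * g₂)) + (u (g₁ * g₂) + u g₃ - u (g₁ * g₂ * g₃))
      + (u (g₁ * g₂ * g₃) + u g₄ - u (g₁ * g₂ * g₃ * g₄))
      + (u (g₁ * g₂ * g₃ * g₄) + u g₅ - u (g₁ * g₂ * g₃ * g₄ * g₅))
      + (u (g₁ * g₂ * g₃ * g₄ * g₅) + u g₆ - u (g₁ * g₂ * g₃ * g₄ * g₅ * g₆))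
      = u g₁ + u g₂ + u g₃ + u g₄ + u g₅ + u g₆ + u g₇ := by
  have hz : g₇ = (g₁ * g₂ * g₃ * g₄ * g₅ * g₆)⁻¹ := eq_inv_of_mul_eq_one_right h
  rw [hz, hodd]
  abel

/-- THE TWO CUTS AGREE (the cocycle identity of THEOREM S21 (a) in coboundary form, census b04.20): for a four-point datum the cut
`{1,2}|{3,4}` gives `w(g₁,g₂) + w(g₁g₂,g₃)` and the cut `{2,3}|{4,1}` gives `w(g₂,g₃) + w(g₁,g₂g₃)`; for a coboundary they coincide
identically (this is `δ(δu) = 0`).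
research route conditional on HC_CM; not a corollary; Q11.4-sentence-2 already refuted in dim ≥ 3. -/
theorem wittCocycle_two_cuts (u : G → A) (g₁ g₂ g₃ : G) :
    (u g₁ + u g₂ - u (g₁ * g₂)) + (u (g₁ * g₂) + u g₃ - u (g₁ * g₂ * g₃))
      = (u g₂ + u g₃ - u (g₂ * g₃)) + (u g₁ + u (g₂ * g₃) - u (g₁ * (g₂ * g₃))) := by
  rw [mul_assoc]
  abel

/-- CYCLIC RECURRENCE, order 3 (THEOREM S21 (f), census b04.20): for `g` of order `3` and `u` odd,
`3 • u g = 2 • w(g,g) + w(g²,g²)` with `w(x,y) = u x + u y - u(x*y)`; in a 2-group of exponent 4 this reads `u(g) = -w(g,g)`, so the local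
term of the class `3A` of `SL₂(5)` is minus the class of the induced equianharmonic elliptic curve `y³ = x(x-1)`.
research route conditional on HC_CM; not a corollary; Q11.4-sentence-2 already refuted in dim ≥ 3. -/
theorem wittCocycle_cyclic_recurrence_three (u : G → A) (hodd : ∀ x : G, u x⁻¹ = -u x) (g : G) (hg : g ^ 3 = 1) :
    (3 : ℕ) • u g = (2 : ℕ) • (u g + u g - u (g * g)) + (u (g * g) + u (g * g) - u (g * g * (g * g))) := by
  have h4 : g * g * (g * g) = g := by
    have : g * g * (g * g) = g ^ 3 * g := by simp only [pow_succ, pow_zero, one_mul, mul_assoc]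
    rw [this, hg, one_mul]
  have h2 : g * g = g⁻¹ := by
    have h3 : g * g * g = 1 := by
      rw [← hg]; simp only [pow_succ, pow_zero, one_mul, mul_assoc]
    exact eq_inv_of_mul_eq_one_left h3
  rw [h4, h2, hodd]
  abel

/-- CYCLIC RECURRENCE, order 5 (THEOREM S21 (f), census b04.20): for `g` of order `5` and `u` odd, with `w_j = w(g^{2^j}, g^{2^j})`,
`15 • u g = 8 • w₀ + 4 • w₁ + 2 • w₂ + w₃` (written with `g⁸ = g³`, `g¹⁶ = g` already substituted, whereupon it is an identity for every `g`); in `W(ℚ₅)` (exponent `4`, `15 ≡ -1`) this is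
`u(g) = 2•w(g,g) + w(g²,g²)`, which expresses the local terms of the classes `5A`, `5B` of `SL₂(5)` through the two genus-2 curves
`y⁵ = x(x-1)` and `y⁵ = x²(x-1)²`.
research route conditional on HC_CM; not a corollary; Q11.4-sentence-2 already refuted in dim ≥ 3. -/
theorem wittCocycle_cyclic_recurrence_five (u : G → A) (g : G) :
    (15 : ℕ) • u g = (8 : ℕ) • (u g + u g - u (g ^ 2)) + (4 : ℕ) • (u (g ^ 2) + u (g ^ 2) - u (g ^ 4))
      + (2 : ℕ) • (u (g ^ 4) + u (g ^ 4) - u (g ^ 3)) + (u (g ^ 3) + u (g ^ 3) - u g) := by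
  abel

end Summit.HodgeConjecture.HodgeConjecture.Ring2.WeilCoverage
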